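import Literature.AnabelianGeometry.SemiGraphs.SubgraphComponentsDoubleCosetsOfDetected
import Literature.AnabelianGeometry.SemiGraphs.SectionDoublePortSwap
import HarnessLib

/-!
# (D3) `covering_subgraphComponents_doubleCosets` WITHOUT branch alignment, over bases every edge-cell of whose covering graph has a non-separating PORT ([SemiAnbd] Cor. 2.7 (i) p. 30)

Mochizuki, *Semi-graphs of anabelioids*, Publ. RIMS **42** (2006), §2, proof of Cor. 2.7 (i) p. 30
("`ℋ′` injects into `𝒢′` as a subgraph"; the two sheets `ℋ″`, `g · ℋ″` of a Galois covering)
[cite: MochizukiSemiAnbd2006, Cor. 2.7(i) p.30]; Def. 2.2 (i) p. 23, Rem. 2.2.1 p. 24.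

PROOF-ONLY (abc-iut cell, layer L3; FACT-LIST row F-1487 `covering_subgraphComponents_doubleCosets`
AS TYPED — local ∧ global ∧ vertex-aligned, NO branch alignment —, CLASS route «regluing invisibility»
of abc-iut-w4-d080, brick R6 (B3) «port-class closer»; seat abc-iut-f-161 (gen 11), tranche 161).
Over `SubgraphComponentsDoubleCosetsOfDetected` ((D3) for every covering whose edge-cells are all
DETECTED, `covering_subgraphComponents_doubleCosets_of_sectionE_surjective`) and abc-iut-L3-d2's PORT
SWAP (`Hom.exists_sectionE_label_of_port`: a cell of `𝔾_A` under a two-sided non-separating cell of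
some `𝔾_Y`, `Y → A` endo-rigid, is detected):

* `Hom.sectionE_detected_of_port` — the port swap in the canonical presentation of the detection
  hypothesis;
* `covering_subgraphComponents_doubleCosets_of_ports` — **THE PORT-CLASS CLOSER: the body of F-1487 AS
  TYPED for EVERY covering of every connected `(𝒢, A)` each of whose edge-cells `(e, Q)` has a port**:
  some `g : Y → A` with all endomorphisms over `A` invertible and a branch-cell of `𝔾_Y` over a branch
  of `e`, two-sided and non-separating in `𝔾_Y`, whose component maps into `Q` — a condition on
  `(𝒢, A)` alone;
* `BObj.ports_of_nonSeparating` — the class of `covering_subgraphComponents_doubleCosets_of_nonSeparating`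
  (every branch-cell of `𝔾_A` two-sided and non-separating) is the sub-class `Y = A`, `g = 𝟙_A`;
* `covering_subgraphComponents_doubleCosets_of_connectedPorts` — the same closer with «`Y` connected» in
  place of endo-rigidity (the shape a port producer supplies).

What is NOT here: the PRODUCTION of ports for essential separating cells of `𝔾_A` from finite-fibre
group theory (abc-iut-w4-d080's R6a) and hair stripping (R7).  CLASS CLOSER ≠ F-1487 AS TYPED; no
definition, no new named fact; nothing here takes a side on [IUTchIII] Cor. 3.12.
-/

namespace Literature.AnabelianGeometry.SemiGraphs

namespace SemiGraphOfAnabelioids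

open CategoryTheory CategoryTheory.Limits CategoryTheory.Functor CategoryTheory.PreGaloisCategory
open Literature.AnabelianGeometry.Anabelioids
open scoped Pointwise

universe v₁ u₁ u

variable {𝒢 𝒢' : SemiGraphOfAnabelioids.{v₁, u₁, u}}

/-- **A two-sided non-separating PORT detects the edge-cell under it** ([SemiAnbd] p. 30, two-sheet
argument at a Galois level; abc-iut-w4-d080's CORE LEMMA, separating half, canonical presentation).
Let `φ : 𝒢′ → 𝒢` carry the global clause data `(α, e_B)` w.r.t. `A`; let `g : Y → A` have all its
endomorphisms over `A` invertible (e.g. `Y` connected, `Anabelioids.isIso_of_isConnected_of_endo`);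
let `bc = (b₀, c)` be a branch-cell of `𝔾_Y` abutting to `vc₀` whose twin branch-cell abuts to `vc₁`,
reachable from `vc₀` by incidences of `𝔾_Y` avoiding `bc`, and whose port `c ⊆ Y_{e(b₀)}` lies over
the component `Q ⊆ A_{e(b₀)}`.  Then the edge-cell `(e(b₀), Q)` of `𝔾_A` is detected
(`Hom.exists_sectionE_label_of_port`, re-indexed by `Hom.sectionE_detected_of_reindex`).
[cite: MochizukiSemiAnbd2006, Cor. 2.7(i) p.30] -/
theorem Hom.sectionE_detected_of_port (φ : Hom 𝒢' 𝒢) (A : 𝒢.BObj) [HasBinaryProducts 𝒢.BObj]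
    (α : Over A ⥤ 𝒢'.BObj) [α.IsEquivalence] (eB : φ.pullbackFunctor ≅ Over.star A ⋙ α)
    {Y : 𝒢.BObj} (g : Y ⟶ A) (hY : ∀ u : Y ⟶ Y, u ≫ g = g → IsIso u)
    (bc : Y.fibreData.total.Branch) {vc₀ vc₁ : Y.fibreData.total.Vertex}
    {bc₁ : Y.fibreData.total.Branch}
    (h₀ : Y.fibreData.total.abuts bc = some vc₀) (h₁ : Y.fibreData.total.abuts bc₁ = some vc₁)
    (hne : bc₁ ≠ bc) (he : Y.fibreData.total.edgeOf bc₁ = Y.fibreData.total.edgeOf bc)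
    (hreach : Relation.ReflTransGen
      (fun x y : Y.fibreData.total.Vertex => ∃ b b' : Y.fibreData.total.Branch,
        b ≠ bc ∧ b' ≠ bc ∧ Y.fibreData.total.edgeOf b = Y.fibreData.total.edgeOf b' ∧
          Y.fibreData.total.abuts b = some x ∧ Y.fibreData.total.abuts b' = some y) vc₀ vc₁)
    (Q : π₀Obj (A.T (𝒢.graph.edgeOf (Y.fibreData.proj.branchMap bc))))
    (hcQ : ∃ k : ((Y.brComp bc).1 : 𝒢.E (𝒢.graph.edgeOf (Y.fibreData.proj.branchMap bc))) ⟶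
        (Q.1 : 𝒢.E (𝒢.graph.edgeOf (Y.fibreData.proj.branchMap bc))),
      k ≫ Q.1.arrow = (Y.brComp bc).1.arrow ≫ g.fT (𝒢.graph.edgeOf (Y.fibreData.proj.branchMap bc))) :
    ∃ (e' : 𝒢'.graph.Edge) (Q' : π₀Obj (A.T (φ.base.edgeMap e'))),
      (⟨φ.base.edgeMap e', Q'⟩ : Σ e, π₀Obj (A.T e)) =
          ⟨𝒢.graph.edgeOf (Y.fibreData.proj.branchMap bc), Q⟩ ∧
      ∃ k : (α.obj (Over.mk (𝟙 A))).T e' ⟶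
          (φ.φE e' (φ.base.edgeMap e') rfl).pullback.obj (Q'.1 : 𝒢.E (φ.base.edgeMap e')),
        k ≫ (φ.φE e' (φ.base.edgeMap e') rfl).pullback.map Q'.1.arrow =
          (α.map ((Over.forgetAdjStar A).unit.app (Over.mk (𝟙 A))) ≫ eB.inv.app A).fT e' := by
  obtain ⟨b', v', h', hb', P, hP, t, ht⟩ :=
    φ.exists_sectionE_label_of_port α eB g hY bc h₀ h₁ hne he hreach Q hcQ
  obtain ⟨Q', hQ', k, hk⟩ := φ.sectionE_detected_of_reindex A α eB (𝒢'.graph.edgeOf b')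
    (𝒢.graph.edgeOf (φ.base.branchMap b')) (φ.base.edgeOf_branchMap b').symm P ⟨t, ht⟩
  exact ⟨𝒢'.graph.edgeOf b', Q', hQ'.trans (Sigma.ext (congrArg 𝒢.graph.edgeOf hb') hP), k, hk⟩

/-- **THE PORT-CLASS CLOSER — (D3) AS TYPED over bases every edge-cell of whose covering graph has a
two-sided non-separating port** ([SemiAnbd] Cor. 2.7 (i) p. 30, "`ℋ′` injects into `𝒢′` as a
subgraph"; Def. 2.2 (i) p. 23 at the TYPED notion of morphism: local ∧ global ∧ vertex-aligned, NO
branch alignment).  For connected `𝒢` and `A ∈ B(𝒢)` such that EVERY edge-cell `(e, Q)` of `𝔾_A` has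
a PORT — some `g : Y → A` all of whose endomorphisms over `A` are invertible and some branch-cell `bc`
of `𝔾_Y` over a branch of `e`, abutting to a vertex-cell, whose twin branch-cell abuts to a vertex-cell
reachable by incidences of `𝔾_Y` avoiding `bc`, and whose component of `Y_e` maps into `Q` under `g` —
EVERY `φ : 𝒢′ → 𝒢` from a connected `𝒢′` which is locally and globally the covering attached to `A`
and vertex-aligned satisfies the body of `covering_subgraphComponents_doubleCosets` ((P1) preimage
components of `ℍ` ↔ `Π_ℍ \ Π_𝒢 / Π′`, (P2) the component through `v′` exists, (P3) it goes to the
class of `Π′` with `ι(Π_{K₀}) = Π′ ∩ Π_ℍ`, (P4) `ι(Π_K) = Π′ ∩ g⁻¹ Π_ℍ g`).  The class of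
`covering_subgraphComponents_doubleCosets_of_nonSeparating` is the case `Y = A`, `g = 𝟙_A`.  (Every
edge-cell is detected by `Hom.sectionE_detected_of_port`, then
`covering_subgraphComponents_doubleCosets_of_sectionE_surjective`.  CLASS CLOSER only: the typed fact,
which quantifies over all `(𝒢, A)`, is not asserted; the PRODUCTION of ports for essential separating
cells — abc-iut-w4-d080's R6a — is not addressed here.) [cite: MochizukiSemiAnbd2006, Cor. 2.7(i) p.30] -/
theorem covering_subgraphComponents_doubleCosets_of_ports :
    ∀ (𝒢 𝒢' : SemiGraphOfAnabelioids.{v₁, u₁, u}) (φ : Hom 𝒢' 𝒢) (A : 𝒢.BObj),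
      𝒢.IsConnected → 𝒢'.IsConnected → φ.IsFiniteEtaleCoveringOf A → φ.IsGlobalCoveringOf A →
      φ.IsVertexAligned →
      (∀ (e : 𝒢.graph.Edge) (Q : π₀Obj (A.T e)),
        ∃ (Y : 𝒢.BObj) (g : Y ⟶ A) (_ : ∀ u : Y ⟶ Y, u ≫ g = g → IsIso u)
          (bc : Y.fibreData.total.Branch) (vc₀ vc₁ : Y.fibreData.total.Vertex)
          (bc₁ : Y.fibreData.total.Branch),
          Y.fibreData.total.abuts bc = some vc₀ ∧ Y.fibreData.total.abuts bc₁ = some vc₁ ∧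
          bc₁ ≠ bc ∧ Y.fibreData.total.edgeOf bc₁ = Y.fibreData.total.edgeOf bc ∧
          Relation.ReflTransGen
            (fun x y : Y.fibreData.total.Vertex => ∃ b b' : Y.fibreData.total.Branch,
              b ≠ bc ∧ b' ≠ bc ∧ Y.fibreData.total.edgeOf b = Y.fibreData.total.edgeOf b' ∧
                Y.fibreData.total.abuts b = some x ∧ Y.fibreData.total.abuts b' = some y) vc₀ vc₁ ∧
          ∃ (Q' : π₀Obj (A.T (𝒢.graph.edgeOf (Y.fibreData.proj.branchMap bc)))),
            (⟨𝒢.graph.edgeOf (Y.fibreData.proj.branchMap bc), Q'⟩ : Σ e, π₀Obj (A.T e)) = ⟨e, Q⟩ ∧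
            ∃ k : ((Y.brComp bc).1 : 𝒢.E (𝒢.graph.edgeOf (Y.fibreData.proj.branchMap bc))) ⟶
                (Q'.1 : 𝒢.E (𝒢.graph.edgeOf (Y.fibreData.proj.branchMap bc))),
              k ≫ Q'.1.arrow =
                (Y.brComp bc).1.arrow ≫ g.fT (𝒢.graph.edgeOf (Y.fibreData.proj.branchMap bc))) →
      ∀ (v' : 𝒢'.graph.Vertex) (F' : 𝒢'.V v' ⥤ FintypeCat.{v₁}) [FiberFunctor F']
        (F : 𝒢.V (φ.base.vertexMap v') ⥤ FintypeCat.{v₁}) [FiberFunctor F]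
        (e : (φ.φV v').pullback ⋙ F' ≅ F)
        (H : 𝒢.graph.Subgraph), H.toSemiGraph.IsConnected → H.toSemiGraph.IsGraph →
        ∀ (hv : φ.base.vertexMap v' ∈ H.verts),
        let v := φ.base.vertexMap v'
        let ι : 𝒢'.Pi v' F' →* 𝒢.Pi v F :=
          (Aut.autMulEquivOfIso (Functor.isoWhiskerLeft (𝒢.ρ v) e)).toMonoidHom.comp
            (pi1Map φ.pullbackFunctor (𝒢'.ρ v' ⋙ F'))
        let PH : Subgroup (𝒢.Pi v F) := (𝒢.piHToPi H ⟨v, hv⟩ F).range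
        ∀ x₀ : (𝒢.ρ v ⋙ F).obj A, ι.range = MulAction.stabilizer (𝒢.Pi v F) x₀ →
          ∃ d : {K : 𝒢'.graph.Subgraph // φ.IsPreimageComponent H K} → 𝒢.Pi v F,
            Function.Bijective (fun K => DoubleCoset.mk PH ι.range (d K)) ∧
            (∃ K₀ : {K : 𝒢'.graph.Subgraph // φ.IsPreimageComponent H K}, v' ∈ K₀.1.verts) ∧
            (∀ (K : {K : 𝒢'.graph.Subgraph // φ.IsPreimageComponent H K}) (hK : v' ∈ K.1.verts),
              d K ∈ ι.range ∧ (ι.comp (𝒢'.piHToPi K.1 ⟨v', hK⟩ F')).range = ι.range ⊓ PH) ∧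
            ∀ (K : {K : 𝒢'.graph.Subgraph // φ.IsPreimageComponent H K})
              (w'' : K.1.toSemiGraph.Vertex) (F'' : 𝒢'.V w''.1 ⥤ FintypeCat.{v₁}) [FiberFunctor F'']
              (α : 𝒢'.ρ w''.1 ⋙ F'' ≅ 𝒢'.ρ v' ⋙ F'),
              ∃ g : 𝒢.Pi v F,
                (ι.comp ((Aut.autMulEquivOfIso α).toMonoidHom.comp (𝒢'.piHToPi K.1 w'' F''))).range =
                  ι.range ⊓ ConjAct.toConjAct g⁻¹ • PH := by
  intro 𝒢 𝒢' φ A h𝒢 h𝒢' hloc hB hva hport v' F' _ F _ e H hH hHg hv v ι PH x₀ hx₀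
  obtain ⟨hprod, α, hα, ⟨eB⟩⟩ := hB
  haveI := hprod
  haveI := hα
  refine covering_subgraphComponents_doubleCosets_of_sectionE_surjective φ A α eB h𝒢 h𝒢' hloc hva
    ?_ v' F' F e H hH hHg hv x₀ hx₀
  intro e Q
  obtain ⟨Y, g, hY, bc, vc₀, vc₁, bc₁, h₀, h₁, hne, he, hreach, Q₁, hQ₁, hcQ⟩ := hport e Q
  obtain ⟨e', Q', hQ', hk⟩ :=
    φ.sectionE_detected_of_port A α eB g hY bc h₀ h₁ hne he hreach Q₁ hcQ
  exact ⟨e', Q', hQ'.trans hQ₁, hk⟩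

/-- **The non-separating class is the port class with `Y = A`**: if every branch-cell of `𝔾_A` abuts to a
vertex-cell and is non-separating, then every edge-cell `(e, Q)` of `𝔾_A` has the port `(A, 𝟙_A)` at
the cell `(b₁, Q)` for either branch `b₁` of `e` (the hypothesis of
`covering_subgraphComponents_doubleCosets_of_ports` from that of
`covering_subgraphComponents_doubleCosets_of_nonSeparating`). [cite: MochizukiSemiAnbd2006, Def. 2.2(i) p.23] -/
theorem BObj.ports_of_nonSeparating (A : 𝒢.BObj)
    (hns : ∀ bc₀ : A.fibreData.total.Branch,
      ∃ (vc₀ vc₁ : A.fibreData.total.Vertex) (bc₁ : A.fibreData.total.Branch),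
        A.fibreData.total.abuts bc₀ = some vc₀ ∧ A.fibreData.total.abuts bc₁ = some vc₁ ∧
        bc₁ ≠ bc₀ ∧ A.fibreData.total.edgeOf bc₁ = A.fibreData.total.edgeOf bc₀ ∧
        Relation.ReflTransGen
          (fun x y : A.fibreData.total.Vertex => ∃ bc bc' : A.fibreData.total.Branch,
            bc ≠ bc₀ ∧ bc' ≠ bc₀ ∧ A.fibreData.total.edgeOf bc = A.fibreData.total.edgeOf bc' ∧
              A.fibreData.total.abuts bc = some x ∧ A.fibreData.total.abuts bc' = some y) vc₀ vc₁)
    (e : 𝒢.graph.Edge) (Q : π₀Obj (A.T e)) :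
    ∃ (Y : 𝒢.BObj) (g : Y ⟶ A) (_ : ∀ u : Y ⟶ Y, u ≫ g = g → IsIso u)
      (bc : Y.fibreData.total.Branch) (vc₀ vc₁ : Y.fibreData.total.Vertex)
      (bc₁ : Y.fibreData.total.Branch),
      Y.fibreData.total.abuts bc = some vc₀ ∧ Y.fibreData.total.abuts bc₁ = some vc₁ ∧
      bc₁ ≠ bc ∧ Y.fibreData.total.edgeOf bc₁ = Y.fibreData.total.edgeOf bc ∧
      Relation.ReflTransGen
        (fun x y : Y.fibreData.total.Vertex => ∃ b b' : Y.fibreData.total.Branch,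
          b ≠ bc ∧ b' ≠ bc ∧ Y.fibreData.total.edgeOf b = Y.fibreData.total.edgeOf b' ∧
            Y.fibreData.total.abuts b = some x ∧ Y.fibreData.total.abuts b' = some y) vc₀ vc₁ ∧
      ∃ (Q' : π₀Obj (A.T (𝒢.graph.edgeOf (Y.fibreData.proj.branchMap bc)))),
        (⟨𝒢.graph.edgeOf (Y.fibreData.proj.branchMap bc), Q'⟩ : Σ e, π₀Obj (A.T e)) = ⟨e, Q⟩ ∧
        ∃ k : ((Y.brComp bc).1 : 𝒢.E (𝒢.graph.edgeOf (Y.fibreData.proj.branchMap bc))) ⟶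
            (Q'.1 : 𝒢.E (𝒢.graph.edgeOf (Y.fibreData.proj.branchMap bc))),
          k ≫ Q'.1.arrow = (Y.brComp bc).1.arrow ≫ g.fT (𝒢.graph.edgeOf (Y.fibreData.proj.branchMap bc)) := by
  obtain ⟨b₁, -, -, hb₁, -, -⟩ := 𝒢.graph.two_branches e
  subst hb₁
  let bc₀ : A.fibreData.total.Branch := ⟨b₁, equivShrink _ Q⟩
  obtain ⟨vc₀, vc₁, bc₁, h₀, h₁, hne, he, hreach⟩ := hns bc₀
  have hQ : A.brComp bc₀ = Q := Equiv.symm_apply_apply _ _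
  have hid : ∀ u : A ⟶ A, u ≫ 𝟙 A = 𝟙 A → IsIso u := fun u hu => by
    rw [Category.comp_id] at hu
    rw [hu]
    infer_instance
  refine ⟨A, 𝟙 A, hid, bc₀, vc₀, vc₁, bc₁, h₀, h₁, hne, he, hreach, A.brComp bc₀, ?_, 𝟙 _, ?_⟩
  · rw [hQ]
    rfl
  · rw [BObj.id_fT, Category.id_comp, Category.comp_id]

/-- **THE PORT-CLASS CLOSER, connected ports** — the form a port PRODUCER supplies ([SemiAnbd] p. 30:
the two sheets live in a connected finite (Galois) étale covering): as
`covering_subgraphComponents_doubleCosets_of_ports`, with the endo-rigidity of `Y → A` replaced by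
«`Y` is CONNECTED» (an endomorphism of a connected object of the Galois category `B(𝒢)` is invertible,
abc-iut-L3-d2's `Anabelioids.isIso_of_isConnected_of_endo`). [cite: MochizukiSemiAnbd2006, Cor. 2.7(i) p.30] -/
theorem covering_subgraphComponents_doubleCosets_of_connectedPorts :
    ∀ (𝒢 𝒢' : SemiGraphOfAnabelioids.{v₁, u₁, u}) (φ : Hom 𝒢' 𝒢) (A : 𝒢.BObj),
      𝒢.IsConnected → 𝒢'.IsConnected → φ.IsFiniteEtaleCoveringOf A → φ.IsGlobalCoveringOf A →
      φ.IsVertexAligned →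
      (∀ (e : 𝒢.graph.Edge) (Q : π₀Obj (A.T e)),
        ∃ (Y : 𝒢.BObj) (_ : PreGaloisCategory.IsConnected Y) (g : Y ⟶ A)
          (bc : Y.fibreData.total.Branch) (vc₀ vc₁ : Y.fibreData.total.Vertex)
          (bc₁ : Y.fibreData.total.Branch),
          Y.fibreData.total.abuts bc = some vc₀ ∧ Y.fibreData.total.abuts bc₁ = some vc₁ ∧
          bc₁ ≠ bc ∧ Y.fibreData.total.edgeOf bc₁ = Y.fibreData.total.edgeOf bc ∧
          Relation.ReflTransGen
            (fun x y : Y.fibreData.total.Vertex => ∃ b b' : Y.fibreData.total.Branch,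
              b ≠ bc ∧ b' ≠ bc ∧ Y.fibreData.total.edgeOf b = Y.fibreData.total.edgeOf b' ∧
                Y.fibreData.total.abuts b = some x ∧ Y.fibreData.total.abuts b' = some y) vc₀ vc₁ ∧
          ∃ (Q' : π₀Obj (A.T (𝒢.graph.edgeOf (Y.fibreData.proj.branchMap bc)))),
            (⟨𝒢.graph.edgeOf (Y.fibreData.proj.branchMap bc), Q'⟩ : Σ e, π₀Obj (A.T e)) = ⟨e, Q⟩ ∧
            ∃ k : ((Y.brComp bc).1 : 𝒢.E (𝒢.graph.edgeOf (Y.fibreData.proj.branchMap bc))) ⟶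
                (Q'.1 : 𝒢.E (𝒢.graph.edgeOf (Y.fibreData.proj.branchMap bc))),
              k ≫ Q'.1.arrow =
                (Y.brComp bc).1.arrow ≫ g.fT (𝒢.graph.edgeOf (Y.fibreData.proj.branchMap bc))) →
      ∀ (v' : 𝒢'.graph.Vertex) (F' : 𝒢'.V v' ⥤ FintypeCat.{v₁}) [FiberFunctor F']
        (F : 𝒢.V (φ.base.vertexMap v') ⥤ FintypeCat.{v₁}) [FiberFunctor F]
        (e : (φ.φV v').pullback ⋙ F' ≅ F)
        (H : 𝒢.graph.Subgraph), H.toSemiGraph.IsConnected → H.toSemiGraph.IsGraph →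
        ∀ (hv : φ.base.vertexMap v' ∈ H.verts),
        let v := φ.base.vertexMap v'
        let ι : 𝒢'.Pi v' F' →* 𝒢.Pi v F :=
          (Aut.autMulEquivOfIso (Functor.isoWhiskerLeft (𝒢.ρ v) e)).toMonoidHom.comp
            (pi1Map φ.pullbackFunctor (𝒢'.ρ v' ⋙ F'))
        let PH : Subgroup (𝒢.Pi v F) := (𝒢.piHToPi H ⟨v, hv⟩ F).range
        ∀ x₀ : (𝒢.ρ v ⋙ F).obj A, ι.range = MulAction.stabilizer (𝒢.Pi v F) x₀ →
          ∃ d : {K : 𝒢'.graph.Subgraph // φ.IsPreimageComponent H K} → 𝒢.Pi v F,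
            Function.Bijective (fun K => DoubleCoset.mk PH ι.range (d K)) ∧
            (∃ K₀ : {K : 𝒢'.graph.Subgraph // φ.IsPreimageComponent H K}, v' ∈ K₀.1.verts) ∧
            (∀ (K : {K : 𝒢'.graph.Subgraph // φ.IsPreimageComponent H K}) (hK : v' ∈ K.1.verts),
              d K ∈ ι.range ∧ (ι.comp (𝒢'.piHToPi K.1 ⟨v', hK⟩ F')).range = ι.range ⊓ PH) ∧
            ∀ (K : {K : 𝒢'.graph.Subgraph // φ.IsPreimageComponent H K})
              (w'' : K.1.toSemiGraph.Vertex) (F'' : 𝒢'.V w''.1 ⥤ FintypeCat.{v₁}) [FiberFunctor F'']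
              (α : 𝒢'.ρ w''.1 ⋙ F'' ≅ 𝒢'.ρ v' ⋙ F'),
              ∃ g : 𝒢.Pi v F,
                (ι.comp ((Aut.autMulEquivOfIso α).toMonoidHom.comp (𝒢'.piHToPi K.1 w'' F''))).range =
                  ι.range ⊓ ConjAct.toConjAct g⁻¹ • PH := by
  intro 𝒢 𝒢' φ A h𝒢 h𝒢' hloc hB hva hport
  refine covering_subgraphComponents_doubleCosets_of_ports 𝒢 𝒢' φ A h𝒢 h𝒢' hloc hB hva ?_
  intro e Q
  obtain ⟨Y, hY, g, bc, vc₀, vc₁, bc₁, hrest⟩ := hport e Q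
  letI := 𝒢.galoisCategory_bObj h𝒢
  haveI := hY
  exact ⟨Y, g, fun u _ => Anabelioids.isIso_of_isConnected_of_endo u, bc, vc₀, vc₁, bc₁, hrest⟩

end SemiGraphOfAnabelioids

end Literature.AnabelianGeometry.SemiGraphs
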